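import Literature.NumberTheory.EllipticCurves.RegulatorProofs
import Literature.NumberTheory.EllipticCurves.BSDInvariantsRegulatorProofs
import Literature.NumberTheory.EllipticCurves.VariableChangePointsMap
import HarnessLib

/-!
# Route `SylvesterTwoHeegnerIndex` (rung K7t), item 19580 `TwoAdicPairHSY`:
# the CM action `[ω] : (x, y) ↦ (ωx, y)` on `y² = x³ + a₆` and the Néron–Tate NORM FORM
# `ĥ(a•X + b•[ω]X) = (a² − ab + b²)·ĥ(X)`

HONEST FRAMING (cell b2b-bsdres, seat x1b GEN 48 = O12 class lead; files `--supports
stmt-BirchSwinnertonDyer-19580`). Item 19580 (`TwoAdicPairHSY`, crux r201 of K7t) says that on the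
Sylvester family 𝒞_HSY the product `#Ш_an(E_p)·#Ш_an(E_{3p²})` has EVEN `2`-adic valuation. It is
OPEN as an item and STAYS OPEN here. This file is the first KERNEL rung of a class-wide attack: it
supplies, with NO named fact and NO new definition, the piece of CM arithmetic that turns
Hu–Shu–Yin's display `#Ш_an(E_p)·#Ш_an(E_{3p²}) = 2^i·ĥ(Y)/ĥ(P)` ([HuShuYin2019] p. 12 (bsd),
`Y ∈ E_p(K)`, `K = ℚ(√−3)`) into a parity statement (sequel `…TwoInertParity.lean`).

The complex multiplication is taken EXACTLY as printed ([HuShuYin2019] p. 4: "We fix the complex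
multiplication `[ ] : O_K ≃ End(E_n)` by `[ω](x, y) = (ωx, y)`"): throughout, `θ` is ANY self-map of
the Mordell–Weil group of a Weierstrass equation in MORDELL FORM (`a₁ = a₂ = a₃ = a₄ = 0`) over a
field containing `ω` (`ω² + ω + 1 = 0`) with `θ 𝒪 = 𝒪` and `θ (x, y) = (ωx, y)` (hypotheses `hθ0`,
`hθ`); such a `θ` EXISTS and is additive (`exists_omegaRot`: the tree's `VariableChange.pointEquiv` of
the admissible change `(u, r, s, t) = (ω, 0, 0, 0)`, which FIXES the equation, `omegaChange_smul`,
followed by the tree's `Affine.Point.congrEquiv`).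

* `nonsingular_omega_mul` — `(ωx, y)` is a nonsingular point when `(x, y)` is;
* `omegaChange_smul`, `omegaChange_toX`, `omegaChange_toY`, `exists_omegaRot` — the construction;
* `omega_mul_add_self`, `add_self_of_X_eq_zero`, `omegaRot_omegaRot_add_omegaRot_add` —
  `[ω²]X + [ω]X + X = 0` (the points `(x,y)`, `(ωx,y)`, `(ω²x,y)` lie on the line `Y = y`; for
  `x = 0` the point is `3`-torsion) — the same chord computation as the tree's
  `Affine.Point.some_add_some_add_some_eq_zero_of_cube` (`J0MulOmega`, for `y² + a₃y = x³ + a₆`),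
  redone here on Mathlib's addition formulae to keep the abelian-variety stack out of the imports;
* `canonicalHeight_omega_mul`, `canonicalHeight_omegaRot` — `ĥ([ω]X) = ĥ(X)` over a number field
  (the tree's PROVED `canonicalHeight_pointEquiv`; [HuShuYin2019] p. 11: "since `|1+ω| = |ω| = 1`");
* `heightPairing_self_omegaRot` — `⟨X, [ω]X⟩ = −ĥ(X)/2`;
* **`canonicalHeight_zsmul_add_zsmul_omegaRot`** — THE NORM FORM
  `ĥ(a•X + b•[ω]X) = (a² − ab + b²)·ĥ(X) = N_{ℚ(ω)/ℚ}(a + bω)·ĥ(X)` for all `a b : ℤ`, from the tree's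
  PROVED heights library (`parallelogram_law_holds`, `heightPairing_zsmul_left/right` of
  `RegulatorProofs`, `canonicalHeight_zsmul_holds`, `canonicalHeight_eq_zero_iff_holds`);
* `isOfFinAddOrder_zsmul_add_zsmul_omegaRot_iff` — `P`, `[ω]P` are `ℤ`-independent modulo torsion
  for `P` non-torsion (the norm form is positive definite).

WHAT THIS IS NOT: not a proof of 19580 for any `p`; nothing about `Ш`; nothing booked, no label
moves. References: [HuShuYin2019] pp. 4, 8, 11, 12; [SilvermanAEC2009] III.1 Table 3.1, III.2.3,
VIII.9.1, VIII.9.3; tree `VariableChangePoints`, `VariableChangePointsMap`, `HeightsProofs`,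
`RegulatorProofs`, `BSDInvariantsRegulatorProofs` (all PROVED; no named fact is consumed by this file).
-/

set_option autoImplicit false
-- the Summit-side namespace `Summit.BirchSwinnertonDyer.BirchSwinnertonDyer.…` (summit = problem) is mandated by D-0017
set_option linter.dupNamespace false

noncomputable section

open scoped Classical

open WeierstrassCurve WeierstrassCurve.Affine WeierstrassCurve.Affine.Point

namespace Summit.BirchSwinnertonDyer.BirchSwinnertonDyer.Theorems.SylvesterTwoCMNormForm

/-! ## §1 The CM action `[ω] : (x, y) ↦ (ωx, y)` on a Mordell equation `y² = x³ + a₆` -/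

section CM

variable {F : Type*} [Field F] {W : WeierstrassCurve F} {ω : F}

/-- `ω ≠ 0` for a root of `X² + X + 1`. [folklore] -/
theorem omega_ne_zero (hω : ω ^ 2 + ω + 1 = 0) : ω ≠ 0 := by
  rintro rfl
  norm_num at hω

/-- `ω³ = 1` for a root of `X² + X + 1`. [folklore] -/
theorem omega_pow_three (hω : ω ^ 2 + ω + 1 = 0) : ω ^ 3 = 1 := by
  linear_combination (ω - 1) * hω

variable (hω : ω ^ 2 + ω + 1 = 0) (h1 : W.a₁ = 0) (h2 : W.a₂ = 0) (h3 : W.a₃ = 0) (h4 : W.a₄ = 0)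

include hω h1 h2 h3 h4

/-- **`(ωx, y)` lies on `y² = x³ + a₆` and is nonsingular when `(x, y)` is** (`(ωx)³ = x³`;
the partial derivatives are `−3x²` resp. `−3ω²x²` and `2y`). [folklore] -/
theorem nonsingular_omega_mul {x y : F} (hp : W.toAffine.Nonsingular x y) :
    W.toAffine.Nonsingular (ω * x) y := by
  have hω3 := omega_pow_three hω
  have hω0 := omega_ne_zero hω
  rw [Affine.nonsingular_iff, Affine.equation_iff] at hp ⊢
  simp only [h1, h2, h3, h4, zero_mul, mul_zero, add_zero, sub_zero] at hp ⊢
  obtain ⟨heq, hns⟩ := hp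
  refine ⟨by rw [heq, mul_pow, hω3, one_mul], ?_⟩
  rcases hns with h | h
  · left
    intro h'
    apply h
    have e : (3 : F) * (ω * x) ^ 2 = ω ^ 2 * (3 * x ^ 2) := by ring
    rw [e] at h'
    have := (mul_eq_zero.mp h'.symm).resolve_left (pow_ne_zero 2 hω0)
    exact this.symm
  · right
    exact h

omit h1 h2 h3 h4 in
/-- `u⁻¹ = ω²` for the unit `u = ω`. [folklore] -/
theorem omega_unit_inv : ((Units.mk0 ω (omega_ne_zero hω))⁻¹ : Fˣ).val = ω ^ 2 := by
  rw [Units.val_inv_eq_inv_val]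
  change ω⁻¹ = ω ^ 2
  exact inv_eq_of_mul_eq_one_right (by rw [← pow_succ']; exact omega_pow_three hω)

/-- **The admissible change `(u, r, s, t) = (ω, 0, 0, 0)` FIXES a Mordell equation**: the new
coefficients are `aᵢ' = ω^{-i} aᵢ` (Silverman, *AEC* III.1 Table 3.1 with `r = s = t = 0`), i.e.
`a₆' = ω⁻⁶ a₆ = a₆` and the others stay `0`. [cite: SilvermanAEC2009, III.1 Table 3.1] -/
theorem omegaChange_smul :
    (⟨Units.mk0 ω (omega_ne_zero hω), 0, 0, 0⟩ : VariableChange F) • W = W := by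
  have hω3 := omega_pow_three hω
  have hu := omega_unit_inv hω
  have h12 : (ω ^ 2) ^ 6 = 1 := by
    calc (ω ^ 2) ^ 6 = (ω ^ 3) ^ 4 := by ring
      _ = 1 := by rw [hω3, one_pow]
  ext
  · rw [variableChange_a₁, h1]
    simp
  · rw [variableChange_a₂, h1, h2]
    simp
  · rw [variableChange_a₃, h1, h3]
    simp
  · rw [variableChange_a₄, h1, h2, h3, h4]
    simp
  · rw [variableChange_a₆, h1, h2, h3, h4, hu, h12]
    simp

omit h1 h2 h3 h4 in
/-- The new `x`-coordinate under `(ω, 0, 0, 0)` is `x' = u⁻²x = ω⁴x = ωx`. [folklore] -/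
theorem omegaChange_toX (x : F) :
    (⟨Units.mk0 ω (omega_ne_zero hω), 0, 0, 0⟩ : VariableChange F).toX x = ω * x := by
  rw [VariableChange.toX, omega_unit_inv hω]
  change (ω ^ 2) ^ 2 * (x - 0) = ω * x
  linear_combination ω * x * omega_pow_three hω

omit h1 h2 h3 h4 in
/-- The new `y`-coordinate under `(ω, 0, 0, 0)` is `y' = u⁻³y = ω⁶y = y`. [folklore] -/
theorem omegaChange_toY (x y : F) :
    (⟨Units.mk0 ω (omega_ne_zero hω), 0, 0, 0⟩ : VariableChange F).toY x y = y := by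
  rw [VariableChange.toY, omega_unit_inv hω]
  change (ω ^ 2) ^ 3 * (y - 0 * (x - 0) - 0) = y
  linear_combination (ω ^ 3 + 1) * y * omega_pow_three hω

/-- **`[ω]` EXISTS as an additive automorphism of the Mordell–Weil group** acting by the printed
formula `[ω](x, y) = (ωx, y)`: the tree's `VariableChange.pointEquiv` of `(ω, 0, 0, 0)` (Silverman,
*AEC* III.1, proof of III.2.5) followed by the transport `Affine.Point.congrEquiv` along
`omegaChange_smul`. [cite: HuShuYin2019, p. 4 (the complex multiplication `[ω](x,y) = (ωx, y)`)] -/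
theorem exists_omegaRot : ∃ θ : W.toAffine.Point ≃+ W.toAffine.Point,
    ∀ (x y : F) (h : W.toAffine.Nonsingular x y),
      θ (.some x y h) = .some (ω * x) y (nonsingular_omega_mul hω h1 h2 h3 h4 h) := by
  refine ⟨(VariableChange.pointEquiv W ⟨Units.mk0 ω (omega_ne_zero hω), 0, 0, 0⟩).trans
    (Affine.Point.congrEquiv (omegaChange_smul hω h1 h2 h3 h4)), fun x y h => ?_⟩
  simp only [AddEquiv.trans_apply, VariableChange.pointEquiv_some, Affine.Point.congrEquiv_some,
    Affine.Point.some.injEq]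
  exact ⟨omegaChange_toX hω x, omegaChange_toY hω x y⟩

/-- **The chord `Y = y`**: for `x ≠ 0` and `ω ≠ 1` the points `(ωx, y)` and `(x, y)` have distinct
abscissae, the secant through them is horizontal, and its third intersection with `y² = x³ + a₆` is
`(ω²x, y)` (`x₃ = λ² − x₁ − x₂ = −(1 + ω)x = ω²x`), so `(ωx, y) + (x, y) = −(ω²x, y)` (Silverman,
*AEC* III.2.3; cf. the tree's `Affine.Point.some_add_some_add_some_eq_zero_of_cube`).
[cite: SilvermanAEC2009, III.2.3] -/
theorem omega_mul_add_self (hω1 : ω ≠ 1) {x y : F} (hp : W.toAffine.Nonsingular x y)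
    (hx : x ≠ 0) :
    (.some (ω * x) y (nonsingular_omega_mul hω h1 h2 h3 h4 hp) : W.toAffine.Point) + .some x y hp =
      -.some (ω * (ω * x)) y
        (nonsingular_omega_mul hω h1 h2 h3 h4 (nonsingular_omega_mul hω h1 h2 h3 h4 hp)) := by
  have hne : ω * x ≠ x := by
    intro h
    apply hω1
    have : (ω - 1) * x = 0 := by linear_combination h
    rcases mul_eq_zero.mp this with h' | h'
    · linear_combination h'
    · exact absurd h' hx
  rw [Affine.Point.add_of_X_ne' hne, neg_inj]
  have hs : W.toAffine.slope (ω * x) x y y = 0 := by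
    rw [Affine.slope_of_X_ne hne, sub_self, zero_div]
  simp only [hs, Affine.addX, Affine.negAddY, h1, h2, Affine.Point.some.injEq]
  constructor
  · linear_combination (-x) * hω
  · ring

omit hω in
/-- For `x = 0` the point `T = (0, y)` (`y² = a₆`, `2y ≠ 0` by nonsingularity) satisfies
`2T = −T` (tangent slope `3x²/2y = 0`), i.e. it is `3`-torsion (Silverman, *AEC* III.2.3).
[cite: SilvermanAEC2009, III.2.3] -/
theorem add_self_of_X_eq_zero {y : F} (hp : W.toAffine.Nonsingular 0 y) :
    (.some 0 y hp : W.toAffine.Point) + .some 0 y hp = -.some 0 y hp := by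
  have hy : y ≠ W.toAffine.negY 0 y := by
    have h := ((Affine.nonsingular_iff 0 y).mp hp).2
    simp only [h1, h2, h3, h4, zero_mul, mul_zero, add_zero, ne_eq] at h
    rcases h with h | h
    · exact absurd (by ring) h
    · simpa [Affine.negY, h1, h3] using h
  rw [Affine.Point.add_self_of_Y_ne' hy, neg_inj]
  have hs : W.toAffine.slope 0 0 y y = 0 := by
    rw [Affine.slope_of_Y_ne rfl hy]
    simp [h1, h2, h4]
  simp only [hs, Affine.addX, Affine.negAddY, h1, h2, Affine.Point.some.injEq]
  constructor <;> ring

variable {θ : W.toAffine.Point → W.toAffine.Point} (hθ0 : θ 0 = 0)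
  (hθ : ∀ (x y : F) (h : W.toAffine.Nonsingular x y),
    θ (.some x y h) = .some (ω * x) y (nonsingular_omega_mul hω h1 h2 h3 h4 h))

include hθ0 hθ

/-- **`[ω²]X + [ω]X + X = 0` on `E(F)`** for every point of a Mordell equation over a field with
`ω² + ω + 1 = 0`, `ω ≠ 1`, and every `θ` acting by `[ω](x, y) = (ωx, y)`, `θ 𝒪 = 𝒪`: the relation
`1 + ω + ω² = 0` of `End(E)` checked on points (chord `Y = y`; `3`-torsion of `(0, y)`).
[cite: HuShuYin2019, p. 4] -/
theorem omegaRot_omegaRot_add_omegaRot_add (hω1 : ω ≠ 1) (P : W.toAffine.Point) :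
    θ (θ P) + θ P + P = 0 := by
  rcases P with _ | ⟨x, y, hp⟩
  · show θ (θ 0) + θ 0 + 0 = 0
    simp only [hθ0, add_zero]
  · by_cases hx : x = 0
    · subst hx
      have e : θ (.some 0 y hp) = .some 0 y hp := by simp only [hθ, mul_zero]
      rw [e, e, add_self_of_X_eq_zero h1 h2 h3 h4, neg_add_cancel]
    · rw [hθ, hθ, add_assoc, omega_mul_add_self hω h1 h2 h3 h4 hω1 hp hx, add_neg_cancel]

/-- Equivalently `X + [ω]X = −[ω]([ω]X)`. [folklore] -/
theorem self_add_omegaRot (hω1 : ω ≠ 1) (P : W.toAffine.Point) : P + θ P = -θ (θ P) := by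
  have h := omegaRot_omegaRot_add_omegaRot_add hω h1 h2 h3 h4 hθ0 hθ hω1 P
  rw [add_assoc, add_comm, add_eq_zero_iff_eq_neg] at h
  rw [add_comm]
  exact h

end CM

/-! ## §2 The Néron–Tate norm form over a number field -/

section NormForm

variable {K : Type*} [Field K] [NumberField K] {W : WeierstrassCurve K} {ω : K}
variable (hω : ω ^ 2 + ω + 1 = 0) (h1 : W.a₁ = 0) (h2 : W.a₂ = 0) (h3 : W.a₃ = 0) (h4 : W.a₄ = 0)

include hω in
/-- In characteristic `0`, a root of `X² + X + 1` is `≠ 1`. [folklore] -/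
theorem omega_ne_one : ω ≠ 1 := by
  rintro rfl
  norm_num at hω

include hω h1 h2 h3 h4

/-- **`ĥ(ωx, y) = ĥ(x, y)`**: the canonical height is invariant under the admissible change of
variables `(ω, 0, 0, 0)` (the tree's PROVED `canonicalHeight_pointEquiv`, Silverman *AEC* VIII.9.1)
and under transport along an equality of equations — Hu–Shu–Yin's "`|ω| = 1`".
[cite: HuShuYin2019, p. 11] [cite: SilvermanAEC2009, Prop. VIII.9.1] -/
theorem canonicalHeight_omega_mul {x y : K} (hp : W.toAffine.Nonsingular x y) :
    canonicalHeight (.some (ω * x) y (nonsingular_omega_mul hω h1 h2 h3 h4 hp) : W.toAffine.Point) =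
      canonicalHeight (.some x y hp : W.toAffine.Point) := by
  have key : ∀ {W₁ W₂ : WeierstrassCurve K} (h : W₁ = W₂) (P : W₁.toAffine.Point),
      canonicalHeight (Affine.Point.congrEquiv h P) = canonicalHeight P := by
    intro W₁ W₂ h P
    subst h
    rfl
  rw [← canonicalHeight_pointEquiv ⟨Units.mk0 ω (omega_ne_zero hω), 0, 0, 0⟩ (.some x y hp),
    ← key (omegaChange_smul hω h1 h2 h3 h4)]
  congr 1
  simp only [VariableChange.pointEquiv_some, Affine.Point.congrEquiv_some, Affine.Point.some.injEq]
  exact ⟨(omegaChange_toX hω x).symm, (omegaChange_toY hω x y).symm⟩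

variable {θ : W.toAffine.Point → W.toAffine.Point} (hθ0 : θ 0 = 0)
  (hθ : ∀ (x y : K) (h : W.toAffine.Nonsingular x y),
    θ (.some x y h) = .some (ω * x) y (nonsingular_omega_mul hω h1 h2 h3 h4 h))

include hθ0 hθ

/-- `ĥ([ω]X) = ĥ(X)` for every `X ∈ E(K)` and every `θ` acting by `[ω](x, y) = (ωx, y)`.
[cite: HuShuYin2019, p. 11] -/
theorem canonicalHeight_omegaRot (P : W.toAffine.Point) : canonicalHeight (θ P) = canonicalHeight P := by
  rcases P with _ | ⟨x, y, hp⟩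
  · show canonicalHeight (θ 0) = canonicalHeight (0 : W.toAffine.Point)
    rw [hθ0]
  · rw [hθ, canonicalHeight_omega_mul hω h1 h2 h3 h4]

omit hω h1 h2 h3 h4 hθ0 hθ in
/-- `ĥ(X + Y) = ĥ(X) + ĥ(Y) + 2⟨X, Y⟩` (the definition of the Néron–Tate pairing, rearranged).
[folklore] -/
theorem canonicalHeight_add (P Q : W.toAffine.Point) :
    canonicalHeight (P + Q) = canonicalHeight P + canonicalHeight Q + 2 * heightPairing P Q := by
  simp only [heightPairing]
  ring

/-- **`⟨X, [ω]X⟩ = −ĥ(X)/2`**: `ĥ(X + [ω]X) = ĥ(−[ω][ω]X) = ĥ(X)`, so the pairing is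
`(ĥ(X) − ĥ(X) − ĥ(X))/2` — Hu–Shu–Yin's "`|1 + ω| = 1`" step. [cite: HuShuYin2019, p. 11] -/
theorem heightPairing_self_omegaRot (P : W.toAffine.Point) :
    heightPairing P (θ P) = -(canonicalHeight P) / 2 := by
  rw [heightPairing, self_add_omegaRot hω h1 h2 h3 h4 hθ0 hθ (omega_ne_one hω), canonicalHeight_neg,
    canonicalHeight_omegaRot hω h1 h2 h3 h4 hθ0 hθ, canonicalHeight_omegaRot hω h1 h2 h3 h4 hθ0 hθ]
  ring

/-- **THE NORM FORM.** For a Mordell equation `y² = x³ + a₆` over a number field containing `ω`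
(`ω² + ω + 1 = 0`), every `θ` acting by `[ω](x, y) = (ωx, y)` and every point `X`:
`ĥ(a•X + b•[ω]X) = (a² − ab + b²)·ĥ(X) = N_{ℚ(ω)/ℚ}(a + bω)·ĥ(X)` — the Néron–Tate height is a
HERMITIAN NORM FORM for the CM action (bilinearity + `ĥ([ω]X) = ĥ(X)` + `1 + ω + ω² = 0`; every
ingredient PROVED in the tree, no named fact). [cite: HuShuYin2019, p. 11 (`|1+ω| = |ω| = 1`)]
[cite: SilvermanAEC2009, Thm. VIII.9.3] -/
theorem canonicalHeight_zsmul_add_zsmul_omegaRot [W.IsElliptic] (a b : ℤ) (P : W.toAffine.Point) :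
    canonicalHeight (a • P + b • θ P) = ((a : ℝ) ^ 2 - a * b + (b : ℝ) ^ 2) * canonicalHeight P := by
  rw [canonicalHeight_add, heightPairing_zsmul_left, heightPairing_zsmul_right,
    heightPairing_self_omegaRot hω h1 h2 h3 h4 hθ0 hθ, canonicalHeight_zsmul_holds,
    canonicalHeight_zsmul_holds, canonicalHeight_omegaRot hω h1 h2 h3 h4 hθ0 hθ]
  ring

/-- `P` and `[ω]P` are `ℤ`-INDEPENDENT modulo torsion as soon as `P` is non-torsion:
`a•P + b•[ω]P` torsion ⟺ `ĥ = 0` ⟺ `a² − ab + b² = 0` ⟺ `a = b = 0` (the norm form is positive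
definite; `ĥ = 0 ↔` torsion is the tree's PROVED `canonicalHeight_eq_zero_iff_holds`). [folklore] -/
theorem isOfFinAddOrder_zsmul_add_zsmul_omegaRot_iff [W.IsElliptic] {a b : ℤ} {P : W.toAffine.Point}
    (hP : ¬IsOfFinAddOrder P) : IsOfFinAddOrder (a • P + b • θ P) ↔ a = 0 ∧ b = 0 := by
  constructor
  · intro h
    have h0 := (canonicalHeight_eq_zero_iff_holds _).mpr h
    rw [canonicalHeight_zsmul_add_zsmul_omegaRot hω h1 h2 h3 h4 hθ0 hθ] at h0
    have hP' : canonicalHeight P ≠ 0 := fun h' => hP ((canonicalHeight_eq_zero_iff_holds P).mp h')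
    have hq : ((a : ℝ) ^ 2 - a * b + (b : ℝ) ^ 2) = 0 := (mul_eq_zero.mp h0).resolve_right hP'
    have hq' : ((2 * a - b : ℤ) : ℝ) ^ 2 + 3 * (b : ℝ) ^ 2 = 0 := by
      push_cast
      linear_combination 4 * hq
    have hb : (b : ℝ) = 0 := by nlinarith [sq_nonneg ((2 * a - b : ℤ) : ℝ), sq_nonneg (b : ℝ)]
    have ha : ((2 * a - b : ℤ) : ℝ) = 0 := by
      nlinarith [sq_nonneg ((2 * a - b : ℤ) : ℝ), sq_nonneg (b : ℝ)]
    have hb' : b = 0 := by exact_mod_cast hb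
    have ha' : 2 * a - b = 0 := by exact_mod_cast ha
    omega
  · rintro ⟨rfl, rfl⟩
    simp only [zero_smul, add_zero]
    exact IsOfFinAddOrder.zero

end NormForm

end Summit.BirchSwinnertonDyer.BirchSwinnertonDyer.Theorems.SylvesterTwoCMNormForm

end
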